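import Literature.Probability.RandomPlanarGeometry.CardyFunctionIncBeta
import Literature.Probability.RandomPlanarGeometry.UpperHalfPlaneAutomorphisms
import Literature.Probability.RandomPlanarGeometry.SchwarzChristoffelTriangle
import HarnessLib

/-!
# Carleson's form of Cardy's formula: the discharge

This file discharges the named fact `Literature.Probability.RandomPlanarGeometry.cardyFunction_crossRatio_eq_of_equilateral`
(**crit-perc.S17**, `Literature.Probability.RandomPlanarGeometry.CritPercCardyFunction`;
Carleson's observation, Bollobás–Riordan 2006, Ch. 7 §1, eq. (3), print pp. 185–186; Werner 2007,
Conj. 2.1; Smirnov 2001, Cor. 3): for the equilateral triangle `abc` with the fourth marked point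
`d` on the side `(ca)`, Cardy's function of the cross-ratio of any uniformizing datum equals
`|d - c| / |a - c|`.

The reduction `Literature.Probability.RandomPlanarGeometry.cardyFunction_crossRatio_eq_of_equilateral_of_facts`
(`CritPercCardyFunctionProofs`) needs three classical inputs, all now proved:

1. `Aut(ℍ) = PSL(2, ℝ)` — `Literature.Probability.RandomPlanarGeometry.conformalEquiv_upperHalfPlaneSet_eq_specialLinearGroup_holds`
   (`UpperHalfPlaneAutomorphisms`; Berenstein–Gay 1991, Exercise 2.3.15 (b));
2. the Schwarz–Christoffel uniformization of the equilateral triangle —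
   `Literature.Probability.RandomPlanarGeometry.schwarzTriangleMap_isUniformizing_holds` (`SchwarzChristoffelTriangle`; Berenstein–Gay
   1991, §2.8, Prop. 2.8.14 and Example (2));
3. `F = B(·; 1/3, 1/3) / B(1/3, 1/3)` on `[0, 1]` — `Literature.Probability.RandomPlanarGeometry.cardyFunction_eq_incBeta13_div_holds`
   (`CardyFunctionIncBeta`; Beals–Wong 2016, §10.7 Exercise 4; Cardy 1992, eqs. (8), (11)).

## References

* B. Bollobás, O. Riordan, *Percolation*, CUP (2006), Ch. 7 §1, eq. (3) (Carleson's form).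
* W. Werner, *Lectures on two-dimensional critical percolation*, arXiv:0710.0856 (2007), Conj. 2.1.
* S. Smirnov, *Critical percolation in the plane*, C. R. Acad. Sci. Paris 333 (2001), Cor. 3.
* C. A. Berenstein, R. Gay, *Complex Variables*, GTM 125, Springer (1991), §2.3, §2.8.
* J. Cardy, *Critical percolation in finite geometries*, J. Phys. A 25 (1992) L201–L206.
-/

namespace Literature.Probability.RandomPlanarGeometry

/-- **Carleson's form of Cardy's formula**
(`Literature.Probability.RandomPlanarGeometry.cardyFunction_crossRatio_eq_of_equilateral` holds, **crit-perc.S17**): for an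
equilateral triangle `abc` and `d ∈ (ca)`, Cardy's function of the cross-ratio of any uniformizing
datum of the conformal rectangle `(abc; a, b, c, d)` equals `|d - c| / |a - c|` (Bollobás–Riordan
2006, Ch. 7 §1, eq. (3); Werner 2007, Conj. 2.1; Smirnov 2001, Cor. 3). Assembled from
`Aut(ℍ) = PSL(2,ℝ)`, the Schwarz–Christoffel uniformization of the equilateral triangle, and
`F = B(·;1/3,1/3)/B(1/3,1/3)`. [cite: BollobasRiordan2006, Ch. 7 §1 eq. (3)] -/
theorem cardyFunction_crossRatio_eq_of_equilateral_holds :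
    RandomPlanarGeometry.cardyFunction_crossRatio_eq_of_equilateral :=
  RandomPlanarGeometry.cardyFunction_crossRatio_eq_of_equilateral_of_facts
    conformalEquiv_upperHalfPlaneSet_eq_specialLinearGroup_holds
    schwarzTriangleMap_isUniformizing_holds cardyFunction_eq_incBeta13_div_holds

end Literature.Probability.RandomPlanarGeometry
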